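import Mathlib
import HarnessLib
import Summits.HubbardSuperconductivity.HubbardSuperconductivity.Theorems.KLProgrammeKLRegimeEngineE4ScaleDoor

/-!
# Route `KLProgramme` — crux K3 ENGINE (gen 7-flow engine-flow child; until the verb: stmt-HubbardSuperconductivity-20236 `KLRegimeEngineV16`),
# input (vii) of the engine-flow skeleton: the (E1-W) DEGREE BUDGET `klWtBudget`

Cell gate-hubbard-kl, seat hubbard-kl-r2d-p2 (g4) — E1 lead per plan g16 KL STATUS 2026-08-27T10:27:28Z («(vii) `klWtBudget` IS YOURS»).  The engine-flow
skeleton threads the engine-private weighted invariant (E1-W) `KernelNormsWt L M (klWtBudget P (klEngQ6 P R) U j) β U μ (K_n) j` (k3c3-p2's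
`…EngineE4ScaleDoor`: all-label WEIGHTED pinned sums `klWtPinnedSum … j m q w` of the sectorised kernels of `𝒱_j` with the scale tree weight
`klScaleWt L M β j = 1 + Λ_j·diam`, bounded by a budget `N m` in every degree `m`).  The template's stand-in body
`Q.CE ^ m * P.Klam * |U| * 2 ^ ((3m − 5) j)` (m = number of legs) is NOT the E1 scale law; this file lands the honest one:

  **`klWtBudget P Q U j m := Q.CE ^ (m/2) · ε_j ^ max(1, m/2 − 1) · 2 ^ ((3·(m/2) − 5)·j)`**, `ε_j = epsCoupling P U j = P.Klam·(|U| + U²·j)`,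

i.e. in every even degree `m = 2p` exactly the law of the public (E1) slot — `CE^p · ε_j^{p−1} · 2^{(3p−5)j}` for `p ≥ 2` (`KernelNormsV4`, …SplitEngineV4) and
`CE · ε_j · 2^{−2j}` at `p = 1` (the two-leg clause of (E1-v3) `KernelNormsV3`, …SplitPredicatesV3) — with the WEIGHT absorbed in the engine-chosen
constant `Q.CE` (Benfatto–Giuliani–Mastropietro 2006 §3 (3.2)–(3.8): the tree expansion's kernels carry the decay `(1 + γ^h|x|)^{−N}` at no cost in the
exponents, only in the constants).  Odd degrees carry the same (irrelevant) number: the action is even.  Consequences recorded here: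

* `klWtBudget_two_mul` / `klWtBudget_two_mul_of_two_le` — the even-degree closed forms; `klWtBudget_nonneg` (`0 ≤ CE`, `0 ≤ Klam`);
* `klAnisoLegKernelNorm_le_of_kernelNormsWt` — (E1-W) dominates the public unweighted sectorised norm in every degree (weight `≥ 1`, constraint set
  `⊆ univ`), hence **`kernelNormsV4_of_kernelNormsWt_klWtBudget`**: `KernelNormsWt L M (klWtBudget P Q U n) β U μ K n → KernelNormsV4 L M P Q β U μ K n` —
  with this budget the (E1-W) conjunct of the skeleton IMPLIES the public (E1-v4) conjunct at the same `(K, n)` (one direction of consistency; k3c3-p2's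
  caveat stands: (E4)ₙ is NOT read off the `m = 4` budget, whose honest size follows the E1 law `≍ 2ʲ`, but off the fixed-label door).

Definitions with bodies + bookkeeping; nothing about the model is asserted.  [cite: BenfattoGiulianiMastropietro2006, §2.8 (2.83), §3 (3.2)–(3.8)]
-/

noncomputable section

namespace Summit.HubbardSuperconductivity.HubbardSuperconductivity.Theorems.EngineV8

set_option linter.dupNamespace false -- summit = problem name (single-conjunct summit), D-0017

open Real Finset Literature.MathematicalPhysics.QuantumLattice Literature.Probability.LatticeModels GrassmannAlgebra
open Summit.HubbardSuperconductivity.HubbardSuperconductivity.Theorems.KLProgrammeLegKernels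
open Summit.HubbardSuperconductivity.HubbardSuperconductivity.Theorems.KLRegimeSplit

/-! ## §1 The budget -/

/-- **The (E1-W) degree budget** `klWtBudget P Q U j m = Q.CE^{⌊m/2⌋} · ε_j^{max(1, ⌊m/2⌋ − 1)} · 2^{(3⌊m/2⌋ − 5)·j}` — the E1 scale law of the public
slot (`KernelNormsV4` for `2p ≥ 4` legs, (E1-v3)'s two-leg clause for `2` legs) as the budget of the WEIGHTED all-label pinned sums of degree `m`
at scale `j` (arity `(P Q U j m)`, threaded as `KernelNormsWt L M (klWtBudget P Q U j) … j`). -/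
def klWtBudget (P : SplitConsts) (Q : EngConsts) (U : ℝ) (j m : ℕ) : ℝ :=
  Q.CE ^ (m / 2) * epsCoupling P U j ^ max 1 (m / 2 - 1) * (2 : ℝ) ^ ((3 * ((m / 2 : ℕ) : ℤ) - 5) * j)

/-- Unfolding `klWtBudget`. -/
theorem klWtBudget_def (P : SplitConsts) (Q : EngConsts) (U : ℝ) (j m : ℕ) :
    klWtBudget P Q U j m = Q.CE ^ (m / 2) * epsCoupling P U j ^ max 1 (m / 2 - 1) * (2 : ℝ) ^ ((3 * ((m / 2 : ℕ) : ℤ) - 5) * j) := rfl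

/-- The coupling size `ε_j = Klam·(|U| + U²·j)` is nonnegative when `Klam ≥ 0`. -/
theorem epsCoupling_nonneg' {P : SplitConsts} (hK : 0 ≤ P.Klam) (U : ℝ) (j : ℕ) : 0 ≤ epsCoupling P U j := by
  unfold epsCoupling; positivity

/-- The budget is nonnegative (`0 ≤ CE`, `0 ≤ Klam`). -/
theorem klWtBudget_nonneg {P : SplitConsts} {Q : EngConsts} (hCE : 0 ≤ Q.CE) (hK : 0 ≤ P.Klam) (U : ℝ) (j m : ℕ) :
    0 ≤ klWtBudget P Q U j m := by
  have hε := epsCoupling_nonneg' hK U j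
  unfold klWtBudget; positivity

/-- **Even degrees**: `klWtBudget P Q U j (2p) = CE^p · ε_j^{max(1,p−1)} · 2^{(3p−5)j}` — the (E1-v3) law `KernelNormsV3` in every `p ≥ 1`. -/
theorem klWtBudget_two_mul (P : SplitConsts) (Q : EngConsts) (U : ℝ) (j p : ℕ) :
    klWtBudget P Q U j (2 * p) = Q.CE ^ p * epsCoupling P U j ^ max 1 (p - 1) * (2 : ℝ) ^ ((3 * (p : ℤ) - 5) * j) := by
  rw [klWtBudget, Nat.mul_div_cancel_left p two_pos]

/-- **Even degrees `2p ≥ 4`**: `klWtBudget P Q U j (2p) = CE^p · ε_j^{p−1} · 2^{(3p−5)j}` — EXACTLY the right-hand side of the public (E1-v4) slot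
`KernelNormsV4`. -/
theorem klWtBudget_two_mul_of_two_le (P : SplitConsts) (Q : EngConsts) (U : ℝ) (j : ℕ) {p : ℕ} (hp : 2 ≤ p) :
    klWtBudget P Q U j (2 * p) = Q.CE ^ p * epsCoupling P U j ^ (p - 1) * (2 : ℝ) ^ ((3 * (p : ℤ) - 5) * j) := by
  rw [klWtBudget_two_mul, max_eq_right (by omega)]

/-- **Two legs**: `klWtBudget P Q U j 2 = CE · ε_j · 4^{−j}` (the (E1-v3) two-leg clause). -/
theorem klWtBudget_two (P : SplitConsts) (Q : EngConsts) (U : ℝ) (j : ℕ) :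
    klWtBudget P Q U j 2 = Q.CE * epsCoupling P U j * (2 : ℝ) ^ (-(2 * (j : ℤ))) := by
  rw [show (2 : ℕ) = 2 * 1 from rfl, klWtBudget_two_mul]
  norm_num

/-- **Four legs**: `klWtBudget P Q U j 4 = CE² · ε_j · 2^{j}` (the E1 scale law `≍ 2ʲ` k3c3-p2's (E4)ₙ caveat refers to). -/
theorem klWtBudget_four (P : SplitConsts) (Q : EngConsts) (U : ℝ) (j : ℕ) :
    klWtBudget P Q U j 4 = Q.CE ^ 2 * epsCoupling P U j * (2 : ℝ) ^ (j : ℤ) := by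
  rw [show (4 : ℕ) = 2 * 2 from rfl, klWtBudget_two_mul_of_two_le P Q U j le_rfl]
  norm_num

/-! ## §2 (E1-W) at this budget dominates the public (E1-v4) -/

variable {L M : ℕ} [NeZero L] [NeZero M]

/-- **The weighted all-label pinned sums dominate the public sectorised norm**: `KernelNormsWt L M N … K n` gives
`klAnisoLegKernelNorm … K klE0 n (m+1) ≤ N (m+1)` in every degree (the sectorised norm is the `L¹–L^∞` norm of the analysed action over the
constraint set, `hubbardSectorKernelNorm_le_kernelNorm_map`; each pinned sum is at most its `klScaleWt`-weighted twin, `one_le_klScaleWt`). -/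
theorem klAnisoLegKernelNorm_le_of_kernelNormsWt {N : ℕ → ℝ} {β U μ : ℝ} (hβ : 0 ≤ β) {K : TrigPolyC4v} {n : ℕ}
    (h : KernelNormsWt L M N β U μ K n) (m : ℕ) : klAnisoLegKernelNorm L M β U μ K klE0 n (m + 1) ≤ N (m + 1) := by
  have hε : 0 ≤ imagTimeWeight β M := imagTimeWeight_nonneg hβ M
  rw [klAnisoLegKernelNorm]
  refine (hubbardSectorKernelNorm_le_kernelNorm_map hβ _ _ _).trans ?_
  have hN0 : 0 ≤ N (m + 1) := (klWtPinnedSum_nonneg L M hβ U μ K n (m + 1) 0 _).trans (h (m + 1) 0 ((0 : SpaceTimeIdx L M),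
    (((⟨0, by unfold sectorCount; positivity⟩ : Fin (sectorCount n)), (0 : Fin 2)), (0 : Fin 2))))
  refine kernelNorm_succ_le_of_forall _ m _ hN0 fun p x => ?_
  refine le_trans ?_ (h (m + 1) p x)
  rw [klWtPinnedSum_def, Nat.add_sub_cancel]
  refine mul_le_mul_of_nonneg_left (sum_le_sum fun X _ => ?_) (pow_nonneg hε m)
  exact le_mul_of_one_le_left (norm_nonneg _) (one_le_klScaleWt L M β n _)

/-- **(E1-W) at the budget `klWtBudget` implies (E1-v4)** at the same frame and scale:
`KernelNormsWt L M (klWtBudget P Q U n) β U μ K n → KernelNormsV4 L M P Q β U μ K n` (`0 ≤ β`). -/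
theorem kernelNormsV4_of_kernelNormsWt_klWtBudget {P : SplitConsts} {Q : EngConsts} {β U μ : ℝ} (hβ : 0 ≤ β) {K : TrigPolyC4v} {n : ℕ}
    (h : KernelNormsWt L M (klWtBudget P Q U n) β U μ K n) : KernelNormsV4 L M P Q β U μ K n := by
  intro p hp
  obtain ⟨m, hm⟩ : ∃ m, 2 * p = m + 1 := ⟨2 * p - 1, by omega⟩
  have h1 := klAnisoLegKernelNorm_le_of_kernelNormsWt hβ h m
  rw [← hm] at h1
  rw [klWtBudget_two_mul_of_two_le P Q U n hp] at h1
  exact h1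

end Summit.HubbardSuperconductivity.HubbardSuperconductivity.Theorems.EngineV8

end
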